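import Summits.BirchSwinnertonDyer.BirchSwinnertonDyer.Theorems.PrintCf2SplitBadEisensteinTwoControlAtTwoOfAtoms
import Summits.BirchSwinnertonDyer.BirchSwinnertonDyer.Theorems.PrintCf2SplitBadEisensteinTwoBdpComposition
import HarnessLib

/-!
# Line `eisenstein_two_bdp_line` (crux `PrintCf2.SplitBadTwoRankOneOfFacts`, stmt-BirchSwinnertonDyer-20368):
# the control machine at `2` against THE CRUX ITSELF

Seat bsd-line-cf2-p1 g6 (LEAD of crux 20368), cell `pub/bsd-print-cf2`. Companion of
`PrintCf2SplitBadEisensteinTwoControlAtTwoOfAtoms.lean` (§1–§3 there: the tree's torsion-aware anticyclotomic (∅,0) control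
machine run at `p = 2` gives defect `0` from two torsion-finiteness atoms + Poitou–Tate; the registered `stub_control_two`
(defect `+1`) is refuted modulo those atoms; the line's typed `2`-adic normalisations are inconsistent with `BSD₂` of the pair
`(W, W^{(d_K)})`). Kept in a separate module because it must import the route file's crux declaration (through the lead's
composition module `PrintCf2SplitBadEisensteinTwoBdpComposition`, which also supplies the Burungale–Flach twin socket).

* `crux_typedNormalisations_inconsistent_of_finAtoms` — with `BSD₂(W)` supplied by THE CRUX (a hypothesis here, with its bundle
  𝔅_split) and `BSD₂(W^{(d_K)})` by Burungale–Flach (`rankZeroTwistBSDp_two_of_hasCM_of_print`): **if the crux is true, then —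
  granted the prints, Poitou–Tate and the two torsion-finiteness atoms at one anticyclotomic frame — no class member admits an
  integral ♭-BDP frame at `𝔭` together with the ♭-IMC EQUALITY at `𝔭′` in the typed normalisation.** The line's research stubs
  `stub_existsIntegralBDP_two` + (`stub_flatEisensteinIncl_two` ∧ `stub_invariantMatch_two`), AS TYPED (skeleton 40d712dab9aaf49c),
  contradict the statement the line composes them into, modulo (Fin_glob) ∧ (Fin_loc) ∧ Poitou–Tate.

BSD is not proved by any of this; CONDITIONAL; the crux is a HYPOTHESIS here; nothing registered is negated unconditionally.

References: Jetchev–Skinner–Wan 2017 Thm. 3.3.1; Burungale–Flach 2024 Cor. 2; Liu–Zhang–Zhang 2018 Thm 1.5.1/1.5.3; Milne 1972 §1 Thm 1.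
-/

noncomputable section

open scoped Classical

open WeierstrassCurve NumberField IsDedekindDomain Field
  Literature.NumberTheory.EllipticCurves
  Literature.NumberTheory.EllipticCurves.ModularForms
  Literature.NumberTheory.EllipticCurves.GreenbergSelmer
  Literature.NumberTheory.GaloisRepresentations
  Literature.NumberTheory.GaloisCohomology
  Literature.NumberTheory.EllipticCurves.Rank1Residual
  Literature.NumberTheory.EllipticCurves.Rank1Residual.Typed
  Summit.BirchSwinnertonDyer.Rank1Residual
  Summit.BirchSwinnertonDyer.Rank1Residual.X11b
  Summit.BirchSwinnertonDyer.Rank1Residual.X11b.AcSelmer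
  Summit.BirchSwinnertonDyer.BirchSwinnertonDyer.Theorems.SchneiderFree
  Summit.BirchSwinnertonDyer.BirchSwinnertonDyer.Theorems.SchneiderFreeControlAtoms
  Summit.BirchSwinnertonDyer.BirchSwinnertonDyer.Theorems.SchneiderFreeAdditiveX3
  Summit.BirchSwinnertonDyer.BirchSwinnertonDyer.Theses.UniversalToricDescent

set_option linter.dupNamespace false
set_option autoImplicit false

namespace Summit.BirchSwinnertonDyer.BirchSwinnertonDyer.Theorems.PrintCf2.EisensteinTwo

/-- **If the crux `PrintCf2.SplitBadTwoRankOneOfFacts` is TRUE, then — granted its bundle 𝔅_split, the line's prints (toric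
inputs, Liu–Zhang–Zhang as typed at `2`, Milne 1972), Poitou–Tate for `K` and the two torsion-finiteness atoms at one anticyclotomic frame — NO
class member admits an integral ♭-BDP frame at `𝔭` together with the ♭-IMC EQUALITY at `𝔭′` in the typed normalisation.**
`BSD₂(W)` comes from the crux, `BSD₂(Wd)` from Burungale–Flach (`rankZeroTwistBSDp_two_of_hasCM_of_print`), and §3 concludes.
So the line's research stubs `stub_existsIntegralBDP_two` + (`stub_flatEisensteinIncl_two` ∧ `stub_invariantMatch_two`), AS TYPED,
contradict the very statement the line composes them into, modulo (Fin_glob) ∧ (Fin_loc) ∧ Poitou–Tate: one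
`2`-power normalisation in the typed frame / LZZ reading / IMC equality must move. CONDITIONAL; closes nothing; the crux is a
HYPOTHESIS here, nothing registered is negated. [cite: JetchevSkinnerWan2017, Thm. 3.3.1 (arXiv:1512.06894 p. 11)]
[cite: BurungaleFlach2024, Thm. 1.1 and Cor. 2] [cite: LiuZhangZhang2018, Thm 1.5.1 and Thm 1.5.3 (Duke Math. J. 167 pp. 748–749)] -/
theorem crux_typedNormalisations_inconsistent_of_finAtoms
    (hCrux : Summit.BirchSwinnertonDyer.BirchSwinnertonDyer.Theses.PrintCf2.SplitBadTwoRankOneOfFacts)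
    (hB : rank_eq_analyticRank_of_analyticRank_le_one ∧ hasEntireLFunction_rat ∧ bsdRHS_eq_of_isIsogenous ∧
      bsdTriple_of_hasCM_of_L_one_ne_zero ∧ KrizLi2019.thm112_bsdTwo_twist)
    (hL : LiuZhangZhang2018.thm151_thm153_modularCurve_heegnerVector_additive) (hF : ToricPublishedInputs)
    (hMilne : Milne1972.bsdQuotient_baseChange_quadratic)
    {K : Type} [Field K] [NumberField K]
    (hPT : poitouTate_selmerStructure_duality K) (hPT2 : poitouTate_sha_tateDual K)
    (W : WeierstrassCurve ℚ) [W.IsElliptic] [W.IsGloballyMinimal] (hCM : W.HasCM) (hr : W.analyticRank = 1)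
    (hsplit2 : CMSplit W 2) (hng : ¬ Good W 2)
    (κ : ZpExtension K 2) (hκ : κ.IsAnticyclotomic) (γ : absoluteGaloisGroup K) [Fact (κ.IsTopGenerator γ)]
    {N : ℕ} [NeZero N] (Dt : ModularParametrizationData W N) (H : HeegnerDatum N (NumberField.discr K))
    (ιK : K →+* ℂ) (P : (W.baseChange K).toAffine.Point)
    (hN : W.conductorNorm ℤ = N) (hK : IsImaginaryQuadratic K) (hHN : SatisfiesHeegnerHypothesis N K)
    (hP : WeierstrassCurve.Affine.Point.map ιK.toRatAlgHom P = heegnerPointComplex Dt H) (hnt : ¬ IsOfFinAddOrder P)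
    (hLt : (W.quadraticTwist (NumberField.discr K : ℚ)).entireLFunction 1 ≠ 0)
    (Wd : WeierstrassCurve ℚ) [Wd.IsElliptic] [Wd.IsGloballyMinimal]
    (hWd : ∃ C : VariableChange ℚ, C • W.quadraticTwist (NumberField.discr K : ℚ) = Wd)
    (𝔭 : HeightOneSpectrum (𝓞 K)) (h𝔭 : ((2 : ℕ) : 𝓞 K) ∈ 𝔭.asIdeal) (he : 𝔭.asIdeal.ramificationIdx (𝓞 ℚ) = 1)
    (hf : 𝔭.asIdeal.inertiaDeg (𝓞 ℚ) = 1)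
    (𝔭' : HeightOneSpectrum (𝓞 K)) (h𝔭' : ((2 : ℕ) : 𝓞 K) ∈ 𝔭'.asIdeal) (he' : 𝔭'.asIdeal.ramificationIdx (𝓞 ℚ) = 1)
    (hf' : 𝔭'.asIdeal.inertiaDeg (𝓞 ℚ) = 1)
    (ι' : PadicAlgCl 2 ≃+* ℂ) (hind : SchneiderFree.BranchInducesPrime 2 ι' 𝔭)
    {ΩK' : ℂ} {Ωp' : ℂ_[2]} {Q : PowerSeries (PadicComplexInt 2)} (hΩK' : ΩK' ≠ 0) (hΩp' : Ωp' ≠ 0)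
    (hQ : R1.IsBDPLFunctionInt 2 ι' 𝔭 κ γ Dt.f ΩK' Ωp' Q)
    (hEq : (XAc.charIdeal (W.baseChange K) 2 κ 𝔭' ∅ γ).map (PowerSeries.map (R1.toCpInt 2)) = Ideal.span {Q})
    (hFinG : Finite (FixedPoints.addSubgroup κ.kerSubgroup (geomPrimaryTorsion (W.baseChange K) 2)))
    (hFinL : LocalTowerTorsionFiniteAt (W.baseChange K) 2 κ 𝔭') : False :=
  eisensteinTwoBdp_typedNormalisations_inconsistent_of_finAtoms hL hF hMilne hPT hPT2 W hCM hr hng κ hκ γ Dt H ιK P hN hK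
    hHN hP hnt hLt Wd hWd (hCrux hB W hCM hr hsplit2 hng)
    (rankZeroTwistBSDp_two_of_hasCM_of_print hB.2.2.2.1 hB.2.1 W hCM N K Wd hN hK hHN hWd hLt)
    𝔭 h𝔭 he hf 𝔭' h𝔭' he' hf' ι' hind hΩK' hΩp' hQ hEq hFinG hFinL

end Summit.BirchSwinnertonDyer.BirchSwinnertonDyer.Theorems.PrintCf2.EisensteinTwo

end
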